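import Literature.AlgebraicGeometry.Resolution.WeightedCentreBottomAPlus
import Literature.AlgebraicGeometry.Resolution.WeightedCentreBottomOrbit
import Literature.AlgebraicGeometry.Resolution.WeightedCentreBottomPureTerm
import HarnessLib

/-!
# Weighted centres — THEOREM A⁺ for a bottom class of weight `2 ≤ r ≤ p − 1`

Instrument for engine 1's `W(f)` TOY MODEL (cell `pub-rosobs`, LF-MODEL-eng1-g45 §6.2 THEOREM A⁺), NOT a resolution theorem and NOT about the invariant of
[AbramovichTemkinWlodarczyk2024].

`false_of_moves_bottom`: let the weights be `≥ 0`, every slot of weight `> p + 1` a fixed heavy slot (`i ∈ V`), `b!·u_b = 1 (b < p)`.  If a graded `k[σ]`-automorphism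
`X₀ ≡ id (mod σ)` fixing `ε_V` and `g` MOVES a slot `z` of minimal weight `w z = r` with `2 ≤ r ≤ p − 1`, then `g` is not (P)-pinned at `z`.  Assembly: the move is a pure term
`cσ^r`, `c ≠ 0` (`exists_apply_CX_bottom`); L2 inside `K` (`eigen_lift_orbit` / `eigen_lift_orbit_exact_or_fix`, `orbitClosure_le_K`) brings `X₀` to eigen form keeping `c`;
then `false_of_dvd` (`r = 2`, `p` odd) or `false_of_three_le` (`r ≥ 3`, exact relation since `K ∩ 𝔄_{p+2} = 1`).  The generator `μ₀` of `𝔽_pˣ` is `EigenLift.exists_orderOf_eq`.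
The case `r = 1` is `false_of_moves_bottom_one` (`WeightedCentreBottomOne`); the positive form for `1 ≤ r ≤ p − 1` and the class formulation are
`WeightedCentreTheoremAPlusLight` / `WeightedCentreTheoremAPlusClass`.  Not covered: bottom weights `r ∈ {p, p+1}` / non-integral (outside LF-MODEL's light setting).

References: [Lang2002, Ch. I §§3, 6, Ch. IV §1, Ch. V §5, Ch. XIII §4]; [Matsumura1987, §27]; [SerreLocalFields1979, Ch. II §4 Lemma 1];
[AbramovichTemkinWlodarczyk2024, §5.1 (p. 1575), Lemma 5.2.10 (p. 1577), Thm. 5.3.1 (2)–(3) (p. 1578)].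
-/

namespace Literature.AlgebraicGeometry.Resolution.WeightedBlowup.BottomClimb

open Polynomial OrderFiltration LevelProjection EigenLiftLevels EigenLift TruncatedFlow ZKernel Truncation

variable {k : Type*} [Field k] {ι : Type*} [Fintype ι] [DecidableEq ι] {w : ι → ℚ} {p : ℕ} [Fact p.Prime] [CharP k p] {u : ℕ → k}

/-- **THEOREM A⁺ (bottom weight `2 ≤ r ≤ p − 1`)** — LF-MODEL-eng1-g45 §6.2: a graded `k[σ]`-automorphism `X₀ ≡ id (mod σ)` fixing the heavy slots `ε_V` and `g` that MOVES a slot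
`z` of minimal weight `w z = r`, `2 ≤ r ≤ p − 1`, contradicts (P) at `z` (`Truncation.SlotPinned w z g`).  Instrument for engine 1's `W(f)` toy model, NOT a resolution theorem.
[cite: AbramovichTemkinWlodarczyk2024, §5.1 (p. 1575), Thm. 5.3.1 (2)–(3) (p. 1578); Lang2002, Ch. IV §1, Ch. V §5, Ch. XIII §4; Matsumura1987, §27] -/
theorem false_of_moves_bottom (hu : ∀ n < p, (Nat.factorial n : k) * u n = 1) (hw : ∀ i, 0 ≤ w i) {V : Set ι}
    (hVw : ∀ i, w i ≤ (p : ℚ) + 1 ∨ i ∈ V) {X₀ : (MvPolynomial ι k)[X] ≃+* (MvPolynomial ι k)[X]} (hg : X₀ ∈ graded w (1 : ℚ))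
    (hb : X₀ ∈ baseFixing) (h1 : X₀ ∈ level (X : (MvPolynomial ι k)[X]) 1) (hV : X₀ ∈ fixSlots V) {g : MvPolynomial ι k}
    (hfix : X₀ (C g) = C g) {z : ι} (hmin : ∀ j, w z ≤ w j) {r : ℕ} (hwz : w z = r) (hr2 : 2 ≤ r) (hrp : r ≤ p - 1)
    (hmove : X₀ (C (MvPolynomial.X z)) ≠ C (MvPolynomial.X z)) (hP : SlotPinned w z g) : False := by
  have hprime : p.Prime := Fact.out
  obtain ⟨μ₀, hμ₀⟩ := exists_orderOf_eq (p := p)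
  -- the move is a pure term `cσ^r`, `c ≠ 0`
  obtain ⟨c, hc⟩ := exists_apply_CX_bottom hw hg h1 hmin hwz (by omega)
  have hc0 : c ≠ 0 := fun h0 => hmove (by rw [hc, h0, map_zero, map_zero, zero_mul, add_zero])
  have hz : X₀ ∈ pureSlot z r := ⟨hb, c, by rw [hc, mul_comm]⟩
  have hbot0 : bottom r X₀ z = c := bottom_eq_of_apply_eq (by rw [hc, mul_comm])
  set n₀ : ℕ := ((μ₀ : ZMod p) ^ r).val with hn₀def
  have hn₀ : (n₀ : ZMod p) = (μ₀ : ZMod p) ^ r := ZMod.natCast_zmod_val _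
  -- reading the data of an element of the orbit group
  have read : ∀ {X' : (MvPolynomial ι k)[X] ≃+* (MvPolynomial ι k)[X]},
      X' ∈ Subgroup.closure (Set.range fun ν : (ZMod p)ˣ => scaleConj (castUnit p ν) X₀) →
        X' ∈ graded w (1 : ℚ) ∧ X' ∈ baseFixing ∧ (∀ i, (p : ℚ) + 1 < w i → X' (C (MvPolynomial.X i)) = C (MvPolynomial.X i)) ∧
          X' (C g) = C g ∧ ∀ c' : k, bottom r X' z = c' → X' (C (MvPolynomial.X z)) = C (MvPolynomial.X z) + C (MvPolynomial.C c') * X ^ r :=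
    fun {X'} hX' => by
    have hK := orbitClosure_le_K p hg hb h1 hV hfix hz hX'
    refine ⟨hK.1.1.1.1.1, hK.1.1.1.1.2, fun i hi => hK.1.1.2 i ((hVw i).resolve_left (not_le.mpr hi)), MulAction.mem_stabilizer_iff.mp hK.1.2,
      fun c' hc' => ?_⟩
    obtain ⟨a, ha⟩ := hK.2.2
    rw [bottom_eq_of_apply_eq ha] at hc'
    rw [ha, hc', mul_comm]
  rcases Nat.lt_or_ge r 3 with hr3 | hr3
  · -- `r = 2`: inexact eigen form with error in `𝔄_{p+1}`, `p` odd
    have hr : r = 2 := by omega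
    subst hr
    have hp3 : 3 ≤ p := by omega
    obtain ⟨m, hm⟩ := hprime.odd_of_ne_two (by omega)
    have hdiv : 2 ∣ p + 1 := ⟨m + 1, by omega⟩
    obtain ⟨X', hX'H, hX'r, hcb, h, hhH, hhl, hsx⟩ := eigen_lift_orbit X₀ hb h1 (Z := {z})
      (fun z' hz' => by rw [Set.mem_singleton_iff.mp hz']; exact hz) le_rfl hrp μ₀ n₀ hn₀ (b := p + 1) (by omega)
      (fun m hm1 hm2 => nonresonant_of_orderOf hμ₀ (by omega) (by omega))
    obtain ⟨hX'g, hX'b, hX'V, hX'fix, hX'z⟩ := read hX'H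
    obtain ⟨hhg, hhb, hhV, -, -⟩ := read hhH
    exact false_of_dvd hu hw hX'g hX'b hX'V le_rfl hrp hX'r hμ₀ hn₀ hhg hhb hhV hhl hsx hdiv hX'fix hmin hwz hc0
      (hX'z c (by rw [hcb z rfl, hbot0])) hP
  · -- `r ≥ 3`: exact eigen form (`K ∩ 𝔄_{p+2} = 1`)
    obtain ⟨X', hX'H, hX'r, hcb, hsx⟩ := eigen_lift_orbit_exact_or_fix p hw hg hb h1 hV hfix hz hr2 hrp (b := p + 2) (by omega) (by omega)
      (fun i => (hVw i).imp_left fun hi => by push_cast; linarith) hμ₀ n₀ hn₀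
    obtain ⟨hX'g, hX'b, hX'V, hX'fix, hX'z⟩ := read hX'H
    exact false_of_three_le hu hw hX'g hX'b hX'V hr3 hrp hX'r hμ₀ hn₀ hsx hX'fix hmin hwz hc0 (hX'z c (by rw [hcb, hbot0])) hP

end Literature.AlgebraicGeometry.Resolution.WeightedBlowup.BottomClimb
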